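import Summits.QuantumFields.YangMills.Theorems.LuscherReductionTwistedTraceScalingBOStiffFibreGapDoor
import Summits.QuantumFields.YangMills.Theorems.LuscherReductionTwistedTraceScalingBOStiffFibreBilinear
import HarnessLib

/-!
# (B-ST) stub (L-3), abstract composition: the fibre bilinear bound `hfib` of `form_le_of_product_near` FROM quasimode data + door data
# (lane A of S-BASE, crux `TwistedTraceScaling` stmt-QuantumFields-20203, C4-CORE, the (B-ST) pen; HANDOFF-g21 UPDATE 21:10Z, spec `g21-FibreBlock-spec.lean`)

`…BOStiffFibreBilinear.kform_bilinear_bound` ∘ `…BOStiffFibreGapDoor.hgap_of_door`: for a bounded measurable symmetric PSD kernel `M`, a profile `Θ ≥ 0` floored on its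
support `S` and vanishing off it, a weight `w` floored on `S`, an upper quasimode with `L²(1/w)` defect (`hup`, `hdef` — target `spec_S3`) and the door data (flat reference
`D`, jump kernel `J₀`, two-sided comparison, jump floor, flat Poincaré with killing slack for all `g` on `S` — target `spec_gap_inputs`):
★★★ `hfib_of_door` — for all bounded measurable `f, f'` vanishing off `S`,
`∫∫ fMf' ≤ Λ((1−θ₁)‖f‖‖f'‖ + (1+η)c(f)c(f') + η₂(c(f)‖f'‖ + c(f')‖f‖))` with `1 − θ₁ = 1 + η − (c_J/(C_νP₀))(1 − C_νδC'_ν)`, `‖f‖ = √∫f²w`, `c(f) = |∫fΘw|/√∫Θ²w` —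
literally the `hfib` hypothesis of `…BOStiffSlowAssembly.form_le_of_product_near` with `A₁ = 1 + η`, `A₂ = η₂`.
HONEST FRAMING: bookkeeping for a stub of a child of the CONDITIONAL route R2b1; (B-ST) OPEN; C4-CORE OPEN; not infinite volume, not a gap, not Clay.
-/

set_option autoImplicit false

noncomputable section

open MeasureTheory

namespace Summit.QuantumFields.YangMills.Theorems.FemtoTransferGap.StiffDoor

variable {X : Type*} [MeasurableSpace X] {μ : Measure X} [IsFiniteMeasure μ]

section Block

variable {M J₀ : X → X → ℝ} {Θ w D : X → ℝ} {CM CΘ Cw CD CJ : ℝ} {S : Set X} {η η₂ Λ Cν C'ν cJ P₀ δ θ₀ w₀ : ℝ}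

/-- ★★★ **The fibre bilinear bound from quasimode + door data** (see the module docstring). [cite: Luscher1983, §3] [cite: SjostrandZworski2007, §2] -/
theorem hfib_of_door (hM : Measurable (Function.uncurry M)) (hMb : ∀ x y, |M x y| ≤ CM) (hsymm : ∀ x y, M x y = M y x)
    (hpsd : ∀ f : X → ℝ, Measurable f → (∃ C : ℝ, ∀ x, |f x| ≤ C) → 0 ≤ ∫ x, ∫ y, f x * M x y * f y ∂μ ∂μ)
    (hΘ : Measurable Θ) (hΘb : ∀ x, |Θ x| ≤ CΘ) (hΘ0 : ∀ x, 0 ≤ Θ x) (hΘS : ∀ x, x ∉ S → Θ x = 0) (hθ₀ : 0 < θ₀) (hΘlo : ∀ x ∈ S, θ₀ ≤ Θ x)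
    (hw : Measurable w) (hwb : ∀ x, |w x| ≤ Cw) (hS : MeasurableSet S) (hw0 : 0 < w₀) (hwlo : ∀ x ∈ S, w₀ ≤ w x) (hZ : 0 < ∫ x in S, Θ x ^ 2 * w x ∂μ)
    (hΛ : 0 < Λ) (hη : 0 ≤ η) (hη₂ : 0 ≤ η₂)
    (hup : ∀ x ∈ S, ∫ y, M x y * Θ y ∂μ ≤ (1 + η) * Λ * (Θ x * w x))
    (hdef : ∫ x in S, ((∫ y, M x y * Θ y ∂μ) - Λ * (Θ x * w x)) ^ 2 / w x ∂μ ≤ (η₂ * Λ) ^ 2 * ∫ x, Θ x ^ 2 * w x ∂μ)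
    (hD : Measurable D) (hDb : ∀ x, |D x| ≤ CD) (hJ₀ : Measurable (Function.uncurry J₀)) (hJ₀b : ∀ x y, |J₀ x y| ≤ CJ) (hZD : 0 < ∫ x in S, D x ∂μ)
    (hν : ∀ x ∈ S, Θ x ^ 2 * w x ≤ Cν * D x) (hCν : 0 < Cν) (hν' : ∀ x ∈ S, D x ≤ C'ν * (Θ x ^ 2 * w x)) (hC'ν : 0 < C'ν)
    (hJ : ∀ x y, cJ * (Λ * J₀ x y) ≤ Θ x * M x y * Θ y) (hcJ : 0 < cJ) (hP₀ : 0 < P₀) (hgain : cJ / (Cν * P₀) ≤ 1) (hδ : 0 ≤ δ)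
    (hflat : ∀ g : X → ℝ, Measurable g → (∃ C : ℝ, ∀ x, |g x| ≤ C) → (∀ x, x ∉ S → g x = 0) →
      (∫ x in S, g x ^ 2 * D x ∂μ) - (∫ x in S, g x * D x ∂μ) ^ 2 / (∫ x in S, D x ∂μ) ≤
        P₀ * ((1 / 2) * ∫ x, ∫ y, (g x - g y) ^ 2 * J₀ x y ∂μ ∂μ) + δ * ∫ x in S, g x ^ 2 * D x ∂μ) :
    ∀ f f' : X → ℝ, Measurable f → (∃ C : ℝ, ∀ x, |f x| ≤ C) → (∀ x, x ∉ S → f x = 0) → Measurable f' → (∃ C : ℝ, ∀ x, |f' x| ≤ C) → (∀ x, x ∉ S → f' x = 0) →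
      ∫ x, ∫ y, f x * M x y * f' y ∂μ ∂μ ≤
        Λ * ((1 + η - (cJ / (Cν * P₀)) * (1 - Cν * δ * C'ν)) * (Real.sqrt (∫ x, f x ^ 2 * w x ∂μ) * Real.sqrt (∫ x, f' x ^ 2 * w x ∂μ)) +
          (1 + η) * (|∫ x, f x * Θ x * w x ∂μ| / Real.sqrt (∫ x, Θ x ^ 2 * w x ∂μ) * (|∫ x, f' x * Θ x * w x ∂μ| / Real.sqrt (∫ x, Θ x ^ 2 * w x ∂μ))) +
          η₂ * (|∫ x, f x * Θ x * w x ∂μ| / Real.sqrt (∫ x, Θ x ^ 2 * w x ∂μ) * Real.sqrt (∫ x, f' x ^ 2 * w x ∂μ) +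
            |∫ x, f' x * Θ x * w x ∂μ| / Real.sqrt (∫ x, Θ x ^ 2 * w x ∂μ) * Real.sqrt (∫ x, f x ^ 2 * w x ∂μ))) := by
  intro f f' hf hCf hfS hf' hCf' hf'S
  obtain ⟨Cf, hCf⟩ := hCf
  obtain ⟨Cf', hCf'⟩ := hCf'
  -- `∫ Θ²w = ∫_S Θ²w > 0`
  have hZ' : 0 < ∫ x, Θ x ^ 2 * w x ∂μ := by
    have e : ∫ x, Θ x ^ 2 * w x ∂μ = ∫ x in S, Θ x ^ 2 * w x ∂μ :=
      (setIntegral_eq_integral_of_forall_compl_eq_zero fun x hx => by rw [hΘS x hx]; ring).symm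
    rwa [e]
  -- the gain is at most `1 + η`
  have hθ : 0 ≤ 1 - (-(η) + cJ / (Cν * P₀) * (1 - Cν * δ * C'ν)) := by
    have hg0 : 0 ≤ cJ / (Cν * P₀) := div_nonneg hcJ.le (mul_pos hCν hP₀).le
    have h1 : cJ / (Cν * P₀) * (1 - Cν * δ * C'ν) ≤ cJ / (Cν * P₀) * 1 :=
      mul_le_mul_of_nonneg_left (by nlinarith [mul_pos hCν hC'ν]) hg0
    linarith
  have hgap := hgap_of_door (μ := μ) hM hMb hsymm hΘ hΘb hΘ0 hθ₀ hΘlo hw hwb hD hDb hJ₀ hJ₀b hS hZ hZD hΛ hup hν hCν hν' hJ hcJ hP₀ hδ hflat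
  have hgap' : ∀ h : X → ℝ, Measurable h → (∃ C : ℝ, ∀ x, |h x| ≤ C) → (∀ x, x ∉ S → h x = 0) → ∫ x, h x * Θ x * w x ∂μ = 0 →
      ∫ x, ∫ y, h x * M x y * h y ∂μ ∂μ ≤ Λ * ((1 - (-(η) + cJ / (Cν * P₀) * (1 - Cν * δ * C'ν))) * ∫ x, h x ^ 2 * w x ∂μ) := by
    intro h hh hC hhS horth
    have := hgap h hh hC hhS horth
    convert this using 3; ring
  have hmain := kform_bilinear_bound (μ := μ) hM hMb hsymm hpsd hΘ hΘb hΘ0 hΘS hw hwb hS hw0 hwlo hZ' hΛ.le hη₂ hθ hup hdef hgap' hf hCf hfS hf' hCf' hf'S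
  convert hmain using 3; ring

end Block

end Summit.QuantumFields.YangMills.Theorems.FemtoTransferGap.StiffDoor

end
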